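import Summits.SmoothPoincare4.SmoothPoincare4.Theorems.ConvexBisectionAcyclicBisectionExistsHgapTwistChart3
import HarnessLib

/-!
# Hgap ▸ part B (page twisting of the straightened dual framed knot), brick R8 (assembly), file 1:
# the columns of the three-dimensional belt-tube chart at a belt point
(wave 7, crux stmt-SmoothPoincare4-10508, line `modp-braid-orbits`, stub `stub_T3_dualPresentation` (T3)
▸ node `Hgap` ▸ part B `helper_Hgap_twisting` ▸ (R8); registered sub-goal `helper_beltChart_columns`)

G2's three-dimensional belt-tube chart (`…HgapTwistChart3.lean`)
`Γ̂ p = (E (seam (β♭ (e^{2πi p₂}, L p)))).1`, `β♭ = (beltMap D j).boundaryTube`, `L p = (p₀, p₁)`,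
restricts on the slice `p₂ = t` to the fibre chart `Γ_t (m) = (E (seam (β♭ (e^{2πit}, m)))).1` of
`…HgapTwistRadial.lean` / `…HgapTwistFraming.lean`, and on the axis `L p = 0` to the pushed belt
circle `s ↦ (E (seam (β♭ (e^{2πis}, 0)))).1`.  This file records the consequences AT A BELT POINT
`p₀ = (0, 0, t)` (`beltChart_columns`, registered `helper_beltChart_columns`): with `Dp = dΓ̂_{p₀}`
(injective, `hasMFDerivAt_beltChart₃`),

* `Λ_t := ∂_m Γ_t (0)` has `Λ_t X = X₀ · Dp e₀ + X₁ · Dp e₁` (chain rule through the affine slice),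
* the velocity of the pushed belt circle at `t` is `Dp e₂`,

hence (§3) `d rho (Λ_t X) = 0`, `Λ_t X ∈ ℝ · T ⇒ X = 0` (`T` the velocity) and
`det4 (∇rho, Λ_t e₀, Λ_t e₁, T) = det4 (∇rho, Dp e₀, Dp e₁, Dp e₂)` = the `det4`-character `χ (p₀)` of
`helper_det4_beltChart_ne_zero` — the inputs `hρ`, `hinj`, `hT0` of G2's `helper_det4_beltFrame_sign`
and the bridge from the character to the page sign `σ̂` used by the assembly (sequel files).

Everything is proved; no named facts, no `sorry`.  References: A. A. Kosinski, *Differential Manifolds*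
(1993), VI §6 [Kosinski1993]; J. M. Lee, *Introduction to Smooth Manifolds* (2013), Prop. 3.6 (chain rule
in coordinates) [LeeSmoothManifolds2013].
-/

noncomputable section

set_option linter.dupNamespace false

open scoped Manifold ContDiff Topology RealInnerProductSpace
open Set Function Metric
open Literature.Topology.FourManifolds Literature.Topology.FourManifolds.HandleAttachingMap
  Literature.Topology.FourManifolds.LefschetzBase Literature.Geometry.Symplectic

namespace Summit.SmoothPoincare4.SmoothPoincare4.Theorems.AcyclicBisectionExists.ModpBraidOrbits

/-! ## §1 The affine slices of `ℝ³` -/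

namespace HBAssembly

/-- The fibre inclusion `X ↦ (X₀, X₁, 0)` of `ℝ²` into `ℝ³`, a continuous linear map. [folklore] -/
theorem exists_fibreIncl : ∃ ι : EuclideanSpace ℝ (Fin 2) →L[ℝ] EuclideanSpace ℝ (Fin 3),
    ∀ X, ι X = X 0 • EuclideanSpace.single (0 : Fin 3) (1 : ℝ) + X 1 • EuclideanSpace.single (1 : Fin 3) (1 : ℝ) :=
  ⟨(EuclideanSpace.proj (𝕜 := ℝ) (0 : Fin 2)).smulRight (EuclideanSpace.single (0 : Fin 3) (1 : ℝ)) +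
    (EuclideanSpace.proj (𝕜 := ℝ) (1 : Fin 2)).smulRight (EuclideanSpace.single (1 : Fin 3) (1 : ℝ)),
    fun _ => rfl⟩

/-- Coordinates of the slice point `(X₀, X₁, 0) + (0, 0, t)`: last coordinate `t`. [folklore] -/
theorem slice_apply_two (X : EuclideanSpace ℝ (Fin 2)) (t : ℝ) :
    (X 0 • EuclideanSpace.single (0 : Fin 3) (1 : ℝ) + X 1 • EuclideanSpace.single (1 : Fin 3) (1 : ℝ) +
      EuclideanSpace.single (2 : Fin 3) t) 2 = t := by
  simp

/-- Coordinates of the slice point `(X₀, X₁, 0) + (0, 0, t)`: fibre part `X`. [folklore] -/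
theorem fibrePart_slice {L : EuclideanSpace ℝ (Fin 3) →L[ℝ] EuclideanSpace ℝ (Fin 2)}
    (hL : ∀ (p : EuclideanSpace ℝ (Fin 3)) (i : Fin 2), L p i = p (Fin.castSucc i))
    (X : EuclideanSpace ℝ (Fin 2)) (t : ℝ) :
    L (X 0 • EuclideanSpace.single (0 : Fin 3) (1 : ℝ) + X 1 • EuclideanSpace.single (1 : Fin 3) (1 : ℝ) +
      EuclideanSpace.single (2 : Fin 3) t) = X := by
  ext i
  rw [hL]
  fin_cases i <;> simp

/-- Coordinates of the axis point `(0, 0, s)`: last coordinate `s`. [folklore] -/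
theorem axis_apply_two (s : ℝ) : (EuclideanSpace.single (2 : Fin 3) s) 2 = s := by
  simp

/-- Coordinates of the axis point `(0, 0, s)`: fibre part `0`. [folklore] -/
theorem fibrePart_axis {L : EuclideanSpace ℝ (Fin 3) →L[ℝ] EuclideanSpace ℝ (Fin 2)}
    (hL : ∀ (p : EuclideanSpace ℝ (Fin 3)) (i : Fin 2), L p i = p (Fin.castSucc i)) (s : ℝ) :
    L (EuclideanSpace.single (2 : Fin 3) s) = 0 := by
  ext i
  rw [hL]
  fin_cases i <;> simp

/-- The axis `s ↦ (0, 0, s)` has velocity `e₂`. [folklore] -/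
theorem hasDerivAt_axis (t : ℝ) :
    HasDerivAt (fun s : ℝ => EuclideanSpace.single (2 : Fin 3) s) (EuclideanSpace.single (2 : Fin 3) (1 : ℝ)) t := by
  have e : (fun s : ℝ => EuclideanSpace.single (2 : Fin 3) s) =
      fun s : ℝ => s • EuclideanSpace.single (2 : Fin 3) (1 : ℝ) := by
    funext s
    ext i
    fin_cases i <;> simp
  rw [e]
  simpa using (hasDerivAt_id t).smul_const (EuclideanSpace.single (2 : Fin 3) (1 : ℝ))

/-- A vector `X₀ e₀ + X₁ e₁ − a e₂ = 0` of `ℝ³` has `X = 0`. [folklore] -/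
theorem eq_zero_of_slice_combo_eq_zero {X : EuclideanSpace ℝ (Fin 2)} {a : ℝ}
    (h0 : X 0 • EuclideanSpace.single (0 : Fin 3) (1 : ℝ) + X 1 • EuclideanSpace.single (1 : Fin 3) (1 : ℝ) -
      a • EuclideanSpace.single (2 : Fin 3) (1 : ℝ) = 0) : X = 0 := by
  have e0 := congrArg (fun v : EuclideanSpace ℝ (Fin 3) => v 0) h0
  have e1 := congrArg (fun v : EuclideanSpace ℝ (Fin 3) => v 1) h0
  simp at e0 e1
  ext i
  fin_cases i
  · exact e0
  · exact e1

end HBAssembly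

open HBAssembly

/-! ## §2 The columns of the chart at a belt point -/

section Chart

variable {g : ℕ} {ι : Type} [Finite ι] {h : ι → HandleAttachingMap 3 2 (Base g)}
  {X : Type} [TopologicalSpace X] [ChartedSpace (EuclideanHalfSpace 4) X] [IsManifold (𝓡∂ 4) ∞ X]
  (D : MultiAttachmentData h (𝓡∂ 4) X) (bX : BoundaryData (𝓡∂ 4) X (𝓡 3))
  (Ψ : bX.carrier ≃ₘ⟮𝓡 3, 𝓡 3⟯ (bBase g).carrier) (E : Base g ≃ₘ^∞⟮𝓡∂ 4, 𝓡∂ 4⟯ Base g) (j : ι)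
  {L : EuclideanSpace ℝ (Fin 3) →L[ℝ] EuclideanSpace ℝ (Fin 2)}

/-- **The columns of the three-dimensional belt-tube chart at a belt point** `p₀ = (0, 0, t)`: the
differential `Dp = dΓ̂_{p₀}` is injective, the fibre chart `Γ_t (m) = (E (seam (β♭ (e^{2πit}, m)))).1`
is differentiable at `0` with `∂_m Γ_t (0) X = X₀ Dp e₀ + X₁ Dp e₁`, and the pushed belt circle
`s ↦ (E (seam (β♭ (e^{2πis}, 0)))).1` has velocity `Dp e₂` at `t`. [cite: LeeSmoothManifolds2013, Prop. 3.6] -/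
theorem beltChart_columns (hL : ∀ (p : EuclideanSpace ℝ (Fin 3)) (i : Fin 2), L p i = p (Fin.castSucc i))
    (t : ℝ) :
    ∃ Dp : EuclideanSpace ℝ (Fin 3) →L[ℝ] EuclideanSpace ℝ (Fin 4), Injective Dp ∧
      HasMFDerivAt 𝓘(ℝ, EuclideanSpace ℝ (Fin 3)) 𝓘(ℝ, EuclideanSpace ℝ (Fin 4))
        (fun p : EuclideanSpace ℝ (Fin 3) => (E ((BoundaryManifold.boundaryData 3 (Base g)).incl
          (seamDiffeo bX (bBase g) Ψ ((beltMap D j).boundaryTube.toHomeo (circlePt (p 2), L p))))).1)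
        (EuclideanSpace.single (2 : Fin 3) t) Dp ∧
      DifferentiableAt ℝ (fun m : EuclideanSpace ℝ (Fin 2) =>
        (E ((BoundaryManifold.boundaryData 3 (Base g)).incl (seamDiffeo bX (bBase g) Ψ
          ((beltMap D j).boundaryTube.toHomeo (circlePt t, m))))).1) 0 ∧
      (∀ X : EuclideanSpace ℝ (Fin 2), fderiv ℝ (fun m : EuclideanSpace ℝ (Fin 2) =>
        (E ((BoundaryManifold.boundaryData 3 (Base g)).incl (seamDiffeo bX (bBase g) Ψ
          ((beltMap D j).boundaryTube.toHomeo (circlePt t, m))))).1) 0 X =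
        X 0 • Dp (EuclideanSpace.single (0 : Fin 3) (1 : ℝ)) + X 1 • Dp (EuclideanSpace.single (1 : Fin 3) (1 : ℝ))) ∧
      HasDerivAt (fun s : ℝ => (E ((BoundaryManifold.boundaryData 3 (Base g)).incl (seamDiffeo bX (bBase g) Ψ
          ((beltMap D j).boundaryTube.toHomeo (circlePt s, (0 : EuclideanSpace ℝ (Fin 2))))))).1)
        (Dp (EuclideanSpace.single (2 : Fin 3) (1 : ℝ))) t := by
  -- the chart and its differential at the belt point
  set Γ : EuclideanSpace ℝ (Fin 3) → EuclideanSpace ℝ (Fin 4) := fun p =>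
    (E ((BoundaryManifold.boundaryData 3 (Base g)).incl (seamDiffeo bX (bBase g) Ψ
      ((beltMap D j).boundaryTube.toHomeo (circlePt (p 2), L p))))).1 with hΓ
  have hp0 : ‖L (EuclideanSpace.single (2 : Fin 3) t)‖ < 1 := by
    rw [fibrePart_axis hL, norm_zero]; exact one_pos
  obtain ⟨Dp, hinj, hD⟩ := hasMFDerivAt_beltChart₃ D bX Ψ E j hL (EuclideanSpace.single (2 : Fin 3) t) hp0
  have hDF : HasFDerivAt Γ Dp (EuclideanSpace.single (2 : Fin 3) t) := hasMFDerivAt_iff_hasFDerivAt.1 hD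
  refine ⟨Dp, hinj, hD, ?_⟩
  -- (a) the fibre slice `m ↦ (m₀, m₁, t)`
  obtain ⟨ι₂, hι₂⟩ := exists_fibreIncl
  set A : EuclideanSpace ℝ (Fin 2) → EuclideanSpace ℝ (Fin 3) := fun m => ι₂ m + EuclideanSpace.single (2 : Fin 3) t
    with hA
  have hA0 : A 0 = EuclideanSpace.single (2 : Fin 3) t := by simp [hA]
  have hAd : HasFDerivAt A ι₂ 0 := ι₂.hasFDerivAt.add_const _
  have hΓA : (fun m : EuclideanSpace ℝ (Fin 2) => (E ((BoundaryManifold.boundaryData 3 (Base g)).incl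
      (seamDiffeo bX (bBase g) Ψ ((beltMap D j).boundaryTube.toHomeo (circlePt t, m))))).1) = Γ ∘ A := by
    funext m
    show _ = (E ((BoundaryManifold.boundaryData 3 (Base g)).incl (seamDiffeo bX (bBase g) Ψ
      ((beltMap D j).boundaryTube.toHomeo (circlePt ((ι₂ m + EuclideanSpace.single (2 : Fin 3) t) 2),
        L (ι₂ m + EuclideanSpace.single (2 : Fin 3) t)))))).1
    rw [hι₂ m, slice_apply_two, fibrePart_slice hL]
  have hDF' : HasFDerivAt Γ Dp (A 0) := by rw [hA0]; exact hDF
  have hslice : HasFDerivAt (Γ ∘ A) (Dp.comp ι₂) 0 := hDF'.comp 0 hAd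
  rw [hΓA]
  refine ⟨hslice.differentiableAt, fun Xv => ?_, ?_⟩
  · rw [hslice.fderiv, ContinuousLinearMap.comp_apply, hι₂, map_add, map_smul, map_smul]
  -- (b) the axis `s ↦ (0, 0, s)`
  have hΓB : (fun s : ℝ => (E ((BoundaryManifold.boundaryData 3 (Base g)).incl (seamDiffeo bX (bBase g) Ψ
      ((beltMap D j).boundaryTube.toHomeo (circlePt s, (0 : EuclideanSpace ℝ (Fin 2))))))).1) =
      Γ ∘ fun s : ℝ => EuclideanSpace.single (2 : Fin 3) s := by
    funext s
    show _ = (E ((BoundaryManifold.boundaryData 3 (Base g)).incl (seamDiffeo bX (bBase g) Ψ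
      ((beltMap D j).boundaryTube.toHomeo (circlePt ((EuclideanSpace.single (2 : Fin 3) s) 2),
        L (EuclideanSpace.single (2 : Fin 3) s)))))).1
    rw [axis_apply_two, fibrePart_axis hL]
  rw [hΓB]
  exact hDF.comp_hasDerivAt t (hasDerivAt_axis t)

/-! ## §3 Consequences: tangency, transversality to the velocity, the character -/

/-- **The fibre derivative is tangent to the boundary**: `d rho (Λ_t X) = 0` for a `rho`-preserving `E`.
[folklore] -/
theorem fderiv_rho_beltChart_fibre (hL : ∀ (p : EuclideanSpace ℝ (Fin 3)) (i : Fin 2), L p i = p (Fin.castSucc i))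
    (hEρ : ∀ x : Base g, rho g (E x).1 = rho g x.1) (t : ℝ) (Xv : EuclideanSpace ℝ (Fin 2)) :
    fderiv ℝ (rho g) (E ((BoundaryManifold.boundaryData 3 (Base g)).incl (seamDiffeo bX (bBase g) Ψ
        ((beltMap D j).boundaryTube.toHomeo (circlePt t, (0 : EuclideanSpace ℝ (Fin 2))))))).1
      (fderiv ℝ (fun m : EuclideanSpace ℝ (Fin 2) =>
        (E ((BoundaryManifold.boundaryData 3 (Base g)).incl (seamDiffeo bX (bBase g) Ψ
          ((beltMap D j).boundaryTube.toHomeo (circlePt t, m))))).1) 0 Xv) = 0 := by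
  obtain ⟨Dp, -, hD, -, hΛ, -⟩ := beltChart_columns D bX Ψ E j hL t
  have hρ := fderiv_rho_beltChart₃ D bX Ψ E j hL hEρ (EuclideanSpace.single (2 : Fin 3) t)
    (by rw [fibrePart_axis hL, norm_zero]; exact one_pos)
  have hpt : (E ((BoundaryManifold.boundaryData 3 (Base g)).incl (seamDiffeo bX (bBase g) Ψ
      ((beltMap D j).boundaryTube.toHomeo (circlePt ((EuclideanSpace.single (2 : Fin 3) t) 2),
        L (EuclideanSpace.single (2 : Fin 3) t)))))).1 =
      (E ((BoundaryManifold.boundaryData 3 (Base g)).incl (seamDiffeo bX (bBase g) Ψ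
        ((beltMap D j).boundaryTube.toHomeo (circlePt t, (0 : EuclideanSpace ℝ (Fin 2))))))).1 := by
    rw [axis_apply_two, fibrePart_axis hL]
  rw [hpt, hD.mfderiv] at hρ
  -- read the tangency in the plain `ℝ⁴` (the `TangentSpace` synonym is definitional)
  have hρ' : ∀ u : EuclideanSpace ℝ (Fin 3),
      fderiv ℝ (rho g) (E ((BoundaryManifold.boundaryData 3 (Base g)).incl (seamDiffeo bX (bBase g) Ψ
        ((beltMap D j).boundaryTube.toHomeo (circlePt t, (0 : EuclideanSpace ℝ (Fin 2))))))).1 (Dp u) = 0 :=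
    fun u => hρ u
  rw [hΛ, map_add, map_smul, map_smul, hρ', hρ', smul_zero, smul_zero, add_zero]

/-- **The fibre derivative meets the line of the velocity only at `0`**: if `Λ_t X = a · T` with `T` the
velocity of the pushed belt circle at `t`, then `X = 0` (the chart is an immersion). [cite: Kosinski1993, VI §6] -/
theorem beltChart_fibre_transversal (hL : ∀ (p : EuclideanSpace ℝ (Fin 3)) (i : Fin 2), L p i = p (Fin.castSucc i))
    (t : ℝ) (Xv : EuclideanSpace ℝ (Fin 2)) (a : ℝ)
    (h0 : fderiv ℝ (fun m : EuclideanSpace ℝ (Fin 2) =>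
        (E ((BoundaryManifold.boundaryData 3 (Base g)).incl (seamDiffeo bX (bBase g) Ψ
          ((beltMap D j).boundaryTube.toHomeo (circlePt t, m))))).1) 0 Xv =
      a • deriv (fun s : ℝ => (E ((BoundaryManifold.boundaryData 3 (Base g)).incl (seamDiffeo bX (bBase g) Ψ
          ((beltMap D j).boundaryTube.toHomeo (circlePt s, (0 : EuclideanSpace ℝ (Fin 2))))))).1) t) :
    Xv = 0 := by
  obtain ⟨Dp, hinj, -, -, hΛ, hT⟩ := beltChart_columns D bX Ψ E j hL t
  rw [hΛ, hT.deriv, ← map_smul, ← map_smul, ← map_add, ← map_smul] at h0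
  have h1 := hinj h0
  exact eq_zero_of_slice_combo_eq_zero (a := a) (by rw [h1, sub_self])

/-- **The velocity of the pushed belt circle does not vanish.** [cite: Kosinski1993, VI §6] -/
theorem deriv_beltCore_ne_zero (hL : ∀ (p : EuclideanSpace ℝ (Fin 3)) (i : Fin 2), L p i = p (Fin.castSucc i))
    (t : ℝ) :
    deriv (fun s : ℝ => (E ((BoundaryManifold.boundaryData 3 (Base g)).incl (seamDiffeo bX (bBase g) Ψ
        ((beltMap D j).boundaryTube.toHomeo (circlePt s, (0 : EuclideanSpace ℝ (Fin 2))))))).1) t ≠ 0 := by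
  obtain ⟨Dp, hinj, -, -, -, hT⟩ := beltChart_columns D bX Ψ E j hL t
  rw [hT.deriv]
  intro h0
  have h1 : EuclideanSpace.single (2 : Fin 3) (1 : ℝ) = 0 := hinj (by rw [h0, map_zero])
  have := congrArg (fun v : EuclideanSpace ℝ (Fin 3) => v 2) h1
  simp at this

/-- **The character at a belt point in fibre/velocity form**: `det4 (N, Λ_t e₀, Λ_t e₁, T)` equals the
`det4`-character `det4 (N, dΓ̂ e₀, dΓ̂ e₁, dΓ̂ e₂)` of the three-dimensional chart at `p₀ = (0, 0, t)`, for any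
first slot `N`. [cite: LeeSmoothManifolds2013, Prop. 3.6] -/
theorem det4_beltChart_fibre_eq (hL : ∀ (p : EuclideanSpace ℝ (Fin 3)) (i : Fin 2), L p i = p (Fin.castSucc i))
    (t : ℝ) (N : EuclideanSpace ℝ (Fin 4)) :
    det4 N
      (fderiv ℝ (fun m : EuclideanSpace ℝ (Fin 2) =>
        (E ((BoundaryManifold.boundaryData 3 (Base g)).incl (seamDiffeo bX (bBase g) Ψ
          ((beltMap D j).boundaryTube.toHomeo (circlePt t, m))))).1) 0 planeE0)
      (fderiv ℝ (fun m : EuclideanSpace ℝ (Fin 2) =>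
        (E ((BoundaryManifold.boundaryData 3 (Base g)).incl (seamDiffeo bX (bBase g) Ψ
          ((beltMap D j).boundaryTube.toHomeo (circlePt t, m))))).1) 0 planeE1)
      (deriv (fun s : ℝ => (E ((BoundaryManifold.boundaryData 3 (Base g)).incl (seamDiffeo bX (bBase g) Ψ
          ((beltMap D j).boundaryTube.toHomeo (circlePt s, (0 : EuclideanSpace ℝ (Fin 2))))))).1) t) =
    det4 N
      (mfderiv 𝓘(ℝ, EuclideanSpace ℝ (Fin 3)) 𝓘(ℝ, EuclideanSpace ℝ (Fin 4))
        (fun p : EuclideanSpace ℝ (Fin 3) => (E ((BoundaryManifold.boundaryData 3 (Base g)).incl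
          (seamDiffeo bX (bBase g) Ψ ((beltMap D j).boundaryTube.toHomeo (circlePt (p 2), L p))))).1)
        (EuclideanSpace.single (2 : Fin 3) t) (EuclideanSpace.single (0 : Fin 3) (1 : ℝ)))
      (mfderiv 𝓘(ℝ, EuclideanSpace ℝ (Fin 3)) 𝓘(ℝ, EuclideanSpace ℝ (Fin 4))
        (fun p : EuclideanSpace ℝ (Fin 3) => (E ((BoundaryManifold.boundaryData 3 (Base g)).incl
          (seamDiffeo bX (bBase g) Ψ ((beltMap D j).boundaryTube.toHomeo (circlePt (p 2), L p))))).1)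
        (EuclideanSpace.single (2 : Fin 3) t) (EuclideanSpace.single (1 : Fin 3) (1 : ℝ)))
      (mfderiv 𝓘(ℝ, EuclideanSpace ℝ (Fin 3)) 𝓘(ℝ, EuclideanSpace ℝ (Fin 4))
        (fun p : EuclideanSpace ℝ (Fin 3) => (E ((BoundaryManifold.boundaryData 3 (Base g)).incl
          (seamDiffeo bX (bBase g) Ψ ((beltMap D j).boundaryTube.toHomeo (circlePt (p 2), L p))))).1)
        (EuclideanSpace.single (2 : Fin 3) t) (EuclideanSpace.single (2 : Fin 3) (1 : ℝ))) := by
  obtain ⟨Dp, -, hD, -, hΛ, hT⟩ := beltChart_columns D bX Ψ E j hL t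
  -- the columns of the chart, read in the plain `ℝ⁴` (the `TangentSpace` synonym is definitional)
  have em : ∀ u : EuclideanSpace ℝ (Fin 3),
      mfderiv 𝓘(ℝ, EuclideanSpace ℝ (Fin 3)) 𝓘(ℝ, EuclideanSpace ℝ (Fin 4))
        (fun p : EuclideanSpace ℝ (Fin 3) => (E ((BoundaryManifold.boundaryData 3 (Base g)).incl
          (seamDiffeo bX (bBase g) Ψ ((beltMap D j).boundaryTube.toHomeo (circlePt (p 2), L p))))).1)
        (EuclideanSpace.single (2 : Fin 3) t) u = Dp u := fun u => by
    rw [hD.mfderiv]; rfl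
  rw [em, em, em, hΛ, hΛ, hT.deriv]
  simp [planeE0, planeE1]

end Chart

/-- **Sub-goal `helper_beltChart_columns` of stub `stub_T3_dualPresentation`** (T3 ▸ node `Hgap` ▸ part B
`helper_Hgap_twisting` ▸ (R8) assembly, file 1; wave 7, lead c5): the fibre derivative of the pushed
belt-tube chart at a belt point meets the line of the velocity of the pushed belt circle only at `0`.
[cite: Kosinski1993, VI §6] -/
theorem helper_beltChart_columns : ∀ (g : ℕ) (ι : Type) [Finite ι] (h : ι → Literature.Topology.FourManifolds.HandleAttachingMap 3 2 (Literature.Topology.FourManifolds.LefschetzBase.Base g)) (X : Type) [TopologicalSpace X] [ChartedSpace (EuclideanHalfSpace 4) X] [IsManifold (𝓡∂ 4) ∞ X] (D : Literature.Topology.FourManifolds.HandleAttachingMap.MultiAttachmentData h (𝓡∂ 4) X) (bX : Literature.Topology.FourManifolds.BoundaryData (𝓡∂ 4) X (𝓡 3)) (Ψ : bX.carrier ≃ₘ⟮𝓡 3, 𝓡 3⟯ (Literature.Topology.FourManifolds.LefschetzBase.bBase g).carrier) (E : Literature.Topology.FourManifolds.LefschetzBase.Base g ≃ₘ^∞⟮𝓡∂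 4, 𝓡∂ 4⟯ Literature.Topology.FourManifolds.LefschetzBase.Base g) (j : ι) (t : ℝ) (Xv : EuclideanSpace ℝ (Fin 2)) (a : ℝ), fderiv ℝ (fun m : EuclideanSpace ℝ (Fin 2) => (E ((Literature.Topology.FourManifolds.BoundaryManifold.boundaryData 3 (Literature.Topology.FourManifolds.LefschetzBase.Base g)).incl (Summit.SmoothPoincare4.SmoothPoincare4.Theorems.AcyclicBisectionExists.ModpBraidOrbits.seamDiffeo bX (Literature.Topology.FourManifolds.LefschetzBase.bBase g) Ψ ((Summit.SmoothPoincare4.SmoothPoincare4.Theorems.AcyclicBisectionExists.ModpBraidOrbits.beltMap D j).boundaryTube.toHomeo (Literature.Topology.FourManifolds.circlePt t, m))))).1) 0 Xv = a • deriv (fun s : ℝ => (E ((Literature.Topology.FourManifolds.BoundaryManifold.boundaryData 3 (Literature.Topology.FourManifolds.LefschetzBase.Base g)).incl (Summit.SmoothPoincare4.SmoothPoincare4.Theorems.AcyclicBisectionExists.ModpBraidOrbits.seamDiffeo bX (Literature.Topology.FourManifolds.LefschetzBase.bBase g) Ψ ((Summit.SmoothPoincare4.SmoothPoincare4.Theorems.AcyclicBisectionExists.ModpBraidOrbits.beltMap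 D j).boundaryTube.toHomeo (Literature.Topology.FourManifolds.circlePt s, (0 : EuclideanSpace ℝ (Fin 2))))))).1) t → Xv = 0 := by
  intro g ι _ h X _ _ _ D bX Ψ E j t Xv a h0
  obtain ⟨L, hL⟩ := exists_lamL3
  exact beltChart_fibre_transversal D bX Ψ E j hL t Xv a h0

end Summit.SmoothPoincare4.SmoothPoincare4.Theorems.AcyclicBisectionExists.ModpBraidOrbits

end
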